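import Mathlib.Analysis.InnerProductSpace.PiL2
import Summits.QuantumFields.YangMills.Theorems.PoincareLipschitzSU2SphereDictionary
import Literature.MathematicalPhysics.QuantumFieldTheory.Balaban1983to89.B4Eq19LatticeOperators
import HarnessLib

/-!
# Crux stmt-QuantumFields-19936 `UnitScaleTilt.HistoryTailL`, route crux `PoincareLipschitz.BlockLipschitzL` (stmt-QuantumFields-23533), K2 organ «LOC-REG-MIN» (`hReg`) —
# [T2] FLAT-SHADOW LETTERS: `ℝ⁴` with the dot product as `EuclideanSpace ℝ (Fin 4)`, orthogonal `4 × 4` matrices and the `SU(2)` bond twists `g ↦ V·g·W⁻¹` as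
# linear isometries with defect `≤ √(8(dist1 V² + dist1 W²))`, and the torus bookkeeping of an equivariant chart `c : ℤ^d → T` (bonds out of ∕ into a charted
# site; no wrap-around on boxes of diameter below the period)

Cell `ym3-torus` (YM ladder rung R3 = continuum SU(2) Yang–Mills on T³ — a RUNG, NOT the Clay problem: not d = 4, not infinite volume, not a mass gap); LEAD
seat `ym-ust-19936-w1` g8 (bus 2026-08-29T05:29Z RULING «K2 END-GAME ARCHITECTURE» + 05:32Z CLAIM [T2]).  Helper `--supports stmt-QuantumFields-19936`; THEOREMS
ONLY (0 `def`, 0 `sorry`, default heartbeats).  FILE 1∕2 of [T2]; FILE 2 ✓`PoincareLipschitzOrbitMinFlatShadow` assembles the flat shadow of an orbit minimiser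
(energy dictionary, twisted one-site optimality, local minimality) over these letters.  Nothing here proves `hImprove`, `hReg`, a chart, a stub, `BlockLipschitzL`,
`HistoryTailL` or a summit statement.

WHY.  The K2 end-game knit `hRegH ⟸ hImprove ∧ [A] ∧ [C] ∧ [D]` needs ONE dictionary between the torus `SU(2)` letters of `hReg`∕[A] and the flat-shadow letters
`u : Zd d → V`, `τ : Fin d → Zd d → (V ≃ₗᵢ[ℝ] V)` of [C] (E→R), [D] (small range) and `hImprove` (✓`PoincareLipschitzCovariantCaccioppoli`'s convention).  Here:
`V := EuclideanSpace ℝ (Fin 4)` via `toLp 2`, the bond twist of ✓`PoincareLipschitzSU2SphereDictionary.exists_orthogonal_twist` as a `LinearIsometryEquiv`, and the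
site∕bond sums of ✓`PoincareLipschitzOrbitMinOneSiteSphere.oneSite_euler_lagrange` re-indexed along a chart.

WHAT IS PROVED (ns `…Theorems.PoincareLipschitzOrbitMinFlatShadow`; `v(g) = (Re g₀₀, Im g₀₀, Re g₁₀, Im g₁₀)`).
* §1 `inner_toLp_eq_dot`, `norm_toLp_sq_eq_dot`, `norm_toLp_eq_one`, `norm_toLp_sub_sq_of_unit` (`‖toLp x − toLp y‖² = 2 − 2x·y` for unit `x, y`),
  ★ `exists_lie_of_orthogonal` (`RᵀR = 1` ⟹ `T : E ≃ₗᵢ[ℝ] E`, `T(toLp x) = toLp(Rx)`, `T⁻¹(toLp x) = toLp(Rᵀx)`), ★ `norm_toLp_mulVec_sub_le`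
  (`‖toLp(Rx) − toLp x‖ ≤ √(ΣΣ(R − 1)²)·‖toLp x‖`, Cauchy–Schwarz row by row).
* §2 ★★ `exists_bond_twist (V W)`: `∃ T`, `T(v g) = v(V·g·W⁻¹)`, `T⁻¹(v g) = v(V⁻¹·g·W)` (all `g`), `‖T w − w‖ ≤ √(8(dist1 V² + dist1 W²))·‖w‖`.
* §3 `shift_injective`, `shift_chart_sub` (`c(y − e_μ) + e_μ = c y`), `src_eq_chart_sub_of_tgt_eq`, `sum_ite_src_eq` (`Σ_{b∈S, b₋ = x} f b = Σ_μ f⟨x, μ⟩`),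
  `sum_ite_tgt_eq` (`Σ_{b∈S, b₊ = c y} f b = Σ_μ f⟨c(y − e_μ), μ⟩`), `chart_add_unitVec` (the standard chart `y ↦ x₀ + y` is equivariant).
* §4 `injOn_chart_box` (`2r < sitesPerDir` ⟹ the standard chart is injective on `Q_r(z)`).
HONEST SCOPE.  Letters only.  YM₃ on T³ is rung R3, not Clay; YM gap NOT proved.

References: Y. L. Xin, Duke Math. J. 47 (1980) 609–613 [Xin1980] (§1: `Sⁿ ⊂ ℝⁿ⁺¹` and its isometries); T. Bałaban, CMP 98 (1985) 17–51 [Balaban1985Averaging]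
((5), (8) p.18: bonds, gauge action).
-/

set_option autoImplicit false

noncomputable section

open scoped BigOperators InnerProductSpace
open Matrix WithLp

namespace Summit.QuantumFields.YangMills.Theorems.PoincareLipschitzOrbitMinFlatShadowLetters

open Literature.MathematicalPhysics.QuantumFieldTheory.Balaban1983to89
open B4Eq19LatticeOperators (Zd box unitVec mem_box box_mono add_unitVec_mem_box sub_unitVec_mem_box)
open Summit.QuantumFields.YangMills.Theorems.PoincareLipschitzSU2SphereDictionary (exists_orthogonal_twist)

/-! ## §1 Euclidean plumbing: `ℝ⁴` with the dot product as `EuclideanSpace ℝ (Fin 4)`; orthogonal matrices as linear isometries -/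

/-- `⟪toLp x, toLp y⟫ = x ⬝ᵥ y`. [folklore] -/
theorem inner_toLp_eq_dot (x y : Fin 4 → ℝ) : ⟪toLp 2 x, toLp 2 y⟫_ℝ = x ⬝ᵥ y := by
  rw [EuclideanSpace.inner_toLp_toLp, star_trivial, dotProduct_comm]

/-- `‖toLp x‖² = x ⬝ᵥ x`. [folklore] -/
theorem norm_toLp_sq_eq_dot (x : Fin 4 → ℝ) : ‖toLp 2 x‖ ^ 2 = x ⬝ᵥ x := by
  rw [← real_inner_self_eq_norm_sq, inner_toLp_eq_dot]

/-- A vector with `x ⬝ᵥ x = 1` has norm one in `EuclideanSpace ℝ (Fin 4)`. [folklore] -/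
theorem norm_toLp_eq_one {x : Fin 4 → ℝ} (hx : x ⬝ᵥ x = 1) : ‖toLp 2 x‖ = 1 := by
  have h := norm_toLp_sq_eq_dot x
  rw [hx] at h
  nlinarith [norm_nonneg (toLp 2 x)]

/-- `‖toLp x − toLp y‖² = 2 − 2·(x ⬝ᵥ y)` for dot-unit vectors. [folklore] -/
theorem norm_toLp_sub_sq_of_unit {x y : Fin 4 → ℝ} (hx : x ⬝ᵥ x = 1) (hy : y ⬝ᵥ y = 1) :
    ‖toLp 2 x - toLp 2 y‖ ^ 2 = 2 - 2 * (x ⬝ᵥ y) := by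
  rw [← real_inner_self_eq_norm_sq, inner_sub_left, inner_sub_right, inner_sub_right, inner_toLp_eq_dot, inner_toLp_eq_dot,
    inner_toLp_eq_dot, inner_toLp_eq_dot, hx, hy, dotProduct_comm y x]
  ring

/-- ★ **AN ORTHOGONAL `4 × 4` MATRIX AS A LINEAR ISOMETRY OF `EuclideanSpace ℝ (Fin 4)`**: `RᵀR = 1` ⟹ there is `T : E ≃ₗᵢ[ℝ] E` with `T (toLp x) = toLp (R x)` and
`T⁻¹ (toLp x) = toLp (Rᵀ x)`. [folklore] -/
theorem exists_lie_of_orthogonal (R : Matrix (Fin 4) (Fin 4) ℝ) (hR : Rᵀ * R = 1) :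
    ∃ T : EuclideanSpace ℝ (Fin 4) ≃ₗᵢ[ℝ] EuclideanSpace ℝ (Fin 4),
      (∀ p : Fin 4 → ℝ, T (toLp 2 p) = toLp 2 (R *ᵥ p)) ∧ (∀ p : Fin 4 → ℝ, T.symm (toLp 2 p) = toLp 2 (Rᵀ *ᵥ p)) := by
  have hR' : R * Rᵀ = 1 := mul_eq_one_comm.mp hR
  let L : EuclideanSpace ℝ (Fin 4) ≃ₗ[ℝ] EuclideanSpace ℝ (Fin 4) :=
    { toFun := fun w => toLp 2 (R *ᵥ ofLp w)
      map_add' := fun x y => by simp [Matrix.mulVec_add]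
      map_smul' := fun c x => by simp [Matrix.mulVec_smul]
      invFun := fun w => toLp 2 (Rᵀ *ᵥ ofLp w)
      left_inv := fun w => by simp [Matrix.mulVec_mulVec, hR]
      right_inv := fun w => by simp [Matrix.mulVec_mulVec, hR'] }
  have hnorm : ∀ w, ‖L w‖ = ‖w‖ := by
    intro w
    have h1 : ‖L w‖ ^ 2 = ‖w‖ ^ 2 := by
      rw [← real_inner_self_eq_norm_sq, ← real_inner_self_eq_norm_sq]
      change ⟪toLp 2 (R *ᵥ ofLp w), toLp 2 (R *ᵥ ofLp w)⟫_ℝ = _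
      rw [EuclideanSpace.inner_toLp_toLp, star_trivial, EuclideanSpace.inner_eq_star_dotProduct, star_trivial]
      calc (R *ᵥ ofLp w) ⬝ᵥ (R *ᵥ ofLp w) = (ofLp w ᵥ* Rᵀ) ⬝ᵥ (R *ᵥ ofLp w) := by rw [Matrix.vecMul_transpose]
        _ = ofLp w ⬝ᵥ (Rᵀ *ᵥ (R *ᵥ ofLp w)) := (Matrix.dotProduct_mulVec (ofLp w) Rᵀ (R *ᵥ ofLp w)).symm
        _ = ofLp w ⬝ᵥ ofLp w := by rw [Matrix.mulVec_mulVec, hR, Matrix.one_mulVec]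
    nlinarith [norm_nonneg (L w), norm_nonneg w, sq_nonneg (‖L w‖ - ‖w‖), sq_nonneg (‖L w‖ + ‖w‖)]
  exact ⟨LinearIsometryEquiv.mk L hnorm, fun p => rfl, fun p => rfl⟩

/-- ★ **FROBENIUS DEFECT ⟹ OPERATOR DEFECT**: `‖toLp (R x) − toLp x‖ ≤ √(Σ_iΣ_a (R − 1)_{ia}²)·‖toLp x‖` (Cauchy–Schwarz row by row). [folklore] -/
theorem norm_toLp_mulVec_sub_le (R : Matrix (Fin 4) (Fin 4) ℝ) (x : Fin 4 → ℝ) :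
    ‖toLp 2 (R *ᵥ x) - toLp 2 x‖ ≤ Real.sqrt (∑ i, ∑ a, (R i a - (1 : Matrix (Fin 4) (Fin 4) ℝ) i a) ^ 2) * ‖toLp 2 x‖ := by
  have hx : ‖toLp 2 x‖ ^ 2 = ∑ a, x a ^ 2 := by
    rw [EuclideanSpace.norm_sq_eq]; simp
  have hd : toLp 2 (R *ᵥ x) - toLp 2 x = toLp 2 ((R - 1) *ᵥ x) := by
    rw [← toLp_sub, Matrix.sub_mulVec, Matrix.one_mulVec]
  rw [hd]
  have hsq : ‖toLp 2 ((R - 1) *ᵥ x)‖ ^ 2 ≤ (∑ i, ∑ a, (R i a - (1 : Matrix (Fin 4) (Fin 4) ℝ) i a) ^ 2) * ‖toLp 2 x‖ ^ 2 := by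
    rw [EuclideanSpace.norm_sq_eq, hx, Finset.sum_mul]
    refine Finset.sum_le_sum fun i _ => ?_
    rw [Real.norm_eq_abs, sq_abs]
    simp only [Matrix.mulVec, dotProduct, Matrix.sub_apply]
    exact Finset.sum_mul_sq_le_sq_mul_sq _ _ _
  have h0 : 0 ≤ Real.sqrt (∑ i, ∑ a, (R i a - (1 : Matrix (Fin 4) (Fin 4) ℝ) i a) ^ 2) * ‖toLp 2 x‖ := by positivity
  nlinarith [Real.sq_sqrt (show 0 ≤ ∑ i, ∑ a, (R i a - (1 : Matrix (Fin 4) (Fin 4) ℝ) i a) ^ 2 by positivity),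
    norm_nonneg (toLp 2 ((R - 1) *ᵥ x)), mul_pow (Real.sqrt (∑ i, ∑ a, (R i a - (1 : Matrix (Fin 4) (Fin 4) ℝ) i a) ^ 2)) ‖toLp 2 x‖ 2]

/-! ## §2 The bond twist: `g ↦ V·g·W⁻¹` read through `SU(2) → S³ ⊂ ℝ⁴` is a linear isometry with defect `≤ √(8(dist1 V² + dist1 W²))` -/

variable {P : Params} {i : ℕ}

/-- ★★ **THE BOND TWIST AS A LINEAR ISOMETRY**: for `V, W ∈ SU(2)` there is `T : ℝ⁴ ≃ₗᵢ ℝ⁴` with `T(v(g)) = v(V·g·W⁻¹)`, `T⁻¹(v(g)) = v(V⁻¹·g·W)` for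
every `g ∈ SU(2)` (`v(g) = (Re g₀₀, Im g₀₀, Re g₁₀, Im g₁₀)`), and `‖T w − w‖ ≤ √(8(dist1 V² + dist1 W²))·‖w‖`. [folklore] [cite: Xin1980, §1] -/
theorem exists_bond_twist (V W : Matrix.specialUnitaryGroup (Fin 2) ℂ) :
    ∃ T : EuclideanSpace ℝ (Fin 4) ≃ₗᵢ[ℝ] EuclideanSpace ℝ (Fin 4),
      (∀ g : Matrix.specialUnitaryGroup (Fin 2) ℂ,
        T (toLp 2 ![((g : Matrix (Fin 2) (Fin 2) ℂ) 0 0).re, ((g : Matrix (Fin 2) (Fin 2) ℂ) 0 0).im,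
            ((g : Matrix (Fin 2) (Fin 2) ℂ) 1 0).re, ((g : Matrix (Fin 2) (Fin 2) ℂ) 1 0).im]) =
          toLp 2 ![(((V * g * W⁻¹ : Matrix.specialUnitaryGroup (Fin 2) ℂ) : Matrix (Fin 2) (Fin 2) ℂ) 0 0).re,
            (((V * g * W⁻¹ : Matrix.specialUnitaryGroup (Fin 2) ℂ) : Matrix (Fin 2) (Fin 2) ℂ) 0 0).im,
            (((V * g * W⁻¹ : Matrix.specialUnitaryGroup (Fin 2) ℂ) : Matrix (Fin 2) (Fin 2) ℂ) 1 0).re,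
            (((V * g * W⁻¹ : Matrix.specialUnitaryGroup (Fin 2) ℂ) : Matrix (Fin 2) (Fin 2) ℂ) 1 0).im]) ∧
      (∀ g : Matrix.specialUnitaryGroup (Fin 2) ℂ,
        T.symm (toLp 2 ![((g : Matrix (Fin 2) (Fin 2) ℂ) 0 0).re, ((g : Matrix (Fin 2) (Fin 2) ℂ) 0 0).im,
            ((g : Matrix (Fin 2) (Fin 2) ℂ) 1 0).re, ((g : Matrix (Fin 2) (Fin 2) ℂ) 1 0).im]) =
          toLp 2 ![(((V⁻¹ * g * W : Matrix.specialUnitaryGroup (Fin 2) ℂ) : Matrix (Fin 2) (Fin 2) ℂ) 0 0).re,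
            (((V⁻¹ * g * W : Matrix.specialUnitaryGroup (Fin 2) ℂ) : Matrix (Fin 2) (Fin 2) ℂ) 0 0).im,
            (((V⁻¹ * g * W : Matrix.specialUnitaryGroup (Fin 2) ℂ) : Matrix (Fin 2) (Fin 2) ℂ) 1 0).re,
            (((V⁻¹ * g * W : Matrix.specialUnitaryGroup (Fin 2) ℂ) : Matrix (Fin 2) (Fin 2) ℂ) 1 0).im]) ∧
      (∀ w, ‖T w - w‖ ≤ Real.sqrt (8 * (GaugeGroup.dist1 V ^ 2 + GaugeGroup.dist1 W ^ 2)) * ‖w‖) := by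
  obtain ⟨R, hR, hdef, hact⟩ := exists_orthogonal_twist V W⁻¹
  obtain ⟨T, hT, hTs⟩ := exists_lie_of_orthogonal R hR
  refine ⟨T, fun g => ?_, fun g => ?_, fun w => ?_⟩
  · rw [hT, ← hact g]
  · -- `v(V⁻¹ g W) = Rᵀ v(g)` from `v(g) = v(V (V⁻¹ g W) W⁻¹) = R v(V⁻¹ g W)` and `RᵀR = 1`
    rw [hTs]
    have h1 := hact (V⁻¹ * g * W)
    have h2 : V * (V⁻¹ * g * W) * W⁻¹ = g := by group
    rw [h2] at h1
    rw [h1, Matrix.mulVec_mulVec, hR, Matrix.one_mulVec]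
  · have h1 : T w - w = toLp 2 (R *ᵥ ofLp w) - toLp 2 (ofLp w) := by
      rw [← hT (ofLp w)]
    rw [h1]
    refine (norm_toLp_mulVec_sub_le R (ofLp w)).trans ?_
    have hw : ‖toLp 2 (ofLp w)‖ = ‖w‖ := rfl
    rw [hw, GaugeGroup.dist1_inv] at *
    exact mul_le_mul_of_nonneg_right (Real.sqrt_le_sqrt hdef) (norm_nonneg w)


/-! ## §3 Torus bookkeeping: shifts, bonds into and out of a site, and equivariant charts `c : ℤ^d → T` (`c(y + e_μ) = c(y) + e_μ`) -/

/-- `x ↦ x + e_μ` is injective on the torus sites. [folklore] -/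
theorem shift_injective {x x' : Site P i} {μ : Fin P.d} (h : Site.shift x μ = Site.shift x' μ) : x = x' := by
  funext k
  have hk := congrFun h k
  by_cases hkμ : k = μ
  · subst hkμ
    simpa [Site.shift, Function.update_apply] using hk
  · simpa [Site.shift, Function.update_apply, hkμ] using hk

/-- For an equivariant chart, `c(y − e_μ) + e_μ = c(y)`. [folklore] -/
theorem shift_chart_sub {c : Zd P.d → Site P i} (hc : ∀ y μ, c (y + unitVec μ) = Site.shift (c y) μ) (y : Zd P.d) (μ : Fin P.d) :
    Site.shift (c (y - unitVec μ)) μ = c y := by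
  rw [← hc, sub_add_cancel]

/-- A bond ENDING at `c(y)` starts at `c(y − e_{dir})`. [folklore] -/
theorem src_eq_chart_sub_of_tgt_eq {c : Zd P.d → Site P i} (hc : ∀ y μ, c (y + unitVec μ) = Site.shift (c y) μ) {b : PBond P i}
    {y : Zd P.d} (hb : b.tgt = c y) : b.src = c (y - unitVec b.dir) :=
  shift_injective (by rw [shift_chart_sub hc]; exact hb)

/-- **BONDS OUT OF A SITE**: if all `d` bonds `⟨x, μ⟩` lie in `S`, then `Σ_{b ∈ S, b₋ = x} f(b) = Σ_μ f⟨x, μ⟩`. [folklore] -/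
theorem sum_ite_src_eq [DecidableEq (PBond P i)] (S : Finset (PBond P i)) (x : Site P i) (hS : ∀ μ, (⟨x, μ⟩ : PBond P i) ∈ S)
    (f : PBond P i → (Fin 4 → ℝ)) :
    (∑ b : PBond P i, if b ∈ S ∧ b.src = x then f b else 0) = ∑ μ, f ⟨x, μ⟩ := by
  classical
  let e : PBond P i ≃ Site P i × Fin P.d := ⟨fun b => (b.src, b.dir), fun p => ⟨p.1, p.2⟩, fun _ => rfl, fun _ => rfl⟩
  rw [← Equiv.sum_comp e.symm, Fintype.sum_prod_type]
  rw [Finset.sum_eq_single x]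
  · refine Finset.sum_congr rfl fun μ _ => ?_
    simp [e, hS μ]
  · intro s _ hs
    refine Finset.sum_eq_zero fun μ _ => ?_
    simp [e, hs]
  · intro hx; exact absurd (Finset.mem_univ x) hx

/-- **BONDS INTO A SITE** (equivariant chart): if all `d` bonds `⟨c(y − e_μ), μ⟩` lie in `S`, then `Σ_{b ∈ S, b₊ = c(y)} f(b) = Σ_μ f⟨c(y − e_μ), μ⟩`. [folklore] -/
theorem sum_ite_tgt_eq [DecidableEq (PBond P i)] (S : Finset (PBond P i)) {c : Zd P.d → Site P i}
    (hc : ∀ y μ, c (y + unitVec μ) = Site.shift (c y) μ) (y : Zd P.d) (hS : ∀ μ, (⟨c (y - unitVec μ), μ⟩ : PBond P i) ∈ S)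
    (f : PBond P i → (Fin 4 → ℝ)) :
    (∑ b : PBond P i, if b ∈ S ∧ b.tgt = c y then f b else 0) = ∑ μ, f ⟨c (y - unitVec μ), μ⟩ := by
  classical
  let e : PBond P i ≃ Site P i × Fin P.d := ⟨fun b => (b.src, b.dir), fun p => ⟨p.1, p.2⟩, fun _ => rfl, fun _ => rfl⟩
  rw [← Equiv.sum_comp e.symm, Fintype.sum_prod_type, Finset.sum_comm]
  refine Finset.sum_congr rfl fun μ _ => ?_
  rw [Finset.sum_eq_single (c (y - unitVec μ))]
  · have ht : (⟨c (y - unitVec μ), μ⟩ : PBond P i).tgt = c y := shift_chart_sub hc y μ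
    simp [e, hS μ, ht]
  · intro s _ hs
    have : ¬ ((⟨s, μ⟩ : PBond P i).tgt = c y) := fun ht => hs (by simpa using src_eq_chart_sub_of_tgt_eq hc ht)
    simp [e, this]
  · intro hx; exact absurd (Finset.mem_univ _) hx

/-- The standard chart `y ↦ x₀ + y (mod the period)` is equivariant. [folklore] -/
theorem chart_add_unitVec (x₀ : Site P i) (y : Zd P.d) (μ : Fin P.d) :
    (fun k => x₀ k + ((y + unitVec μ) k : ZMod (P.sitesPerDir i)) : Site P i) =
      Site.shift (fun k => x₀ k + (y k : ZMod (P.sitesPerDir i)) : Site P i) μ := by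
  funext k
  by_cases hk : k = μ
  · subst hk
    simp [Site.shift, unitVec, add_assoc]
  · simp [Site.shift, unitVec, hk]


/-! ## §4 The standard chart is injective on boxes of diameter below the period -/

/-- **NO WRAP-AROUND**: the standard chart `y ↦ x₀ + y` is injective on `Q_r(z)` as soon as `2r < sitesPerDir`. [folklore] -/
theorem injOn_chart_box (x₀ : Site P i) (z : Zd P.d) {r : ℤ} (hr : 2 * r < (P.sitesPerDir i : ℤ)) :
    Set.InjOn (fun y : Zd P.d => (fun k => x₀ k + (y k : ZMod (P.sitesPerDir i)) : Site P i)) ↑(box z r) := by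
  intro y hy y' hy' hyy
  funext k
  have hk : x₀ k + (y k : ZMod (P.sitesPerDir i)) = x₀ k + (y' k : ZMod (P.sitesPerDir i)) := congrFun hyy k
  have hk' : ((y k : ℤ) : ZMod (P.sitesPerDir i)) = ((y' k : ℤ) : ZMod (P.sitesPerDir i)) := add_left_cancel hk
  have hdvd : ((P.sitesPerDir i : ℕ) : ℤ) ∣ y' k - y k := (ZMod.intCast_eq_intCast_iff_dvd_sub _ _ _).mp hk'
  have h1 := (mem_box.mp (Finset.mem_coe.mp hy)) k
  have h2 := (mem_box.mp (Finset.mem_coe.mp hy')) k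
  have habs : |y' k - y k| < (P.sitesPerDir i : ℤ) := by
    have : |y' k - y k| ≤ |y' k - z k| + |y k - z k| := by
      rw [show y' k - y k = (y' k - z k) - (y k - z k) by ring]; exact abs_sub _ _
    linarith
  have := Int.eq_zero_of_abs_lt_dvd hdvd habs
  linarith

end Summit.QuantumFields.YangMills.Theorems.PoincareLipschitzOrbitMinFlatShadowLetters

end
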